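import Summits.BirchSwinnertonDyer.BirchSwinnertonDyer.Theorems.PrintX9JetchevX9SwapBridge
import Summits.BirchSwinnertonDyer.BirchSwinnertonDyer.Theorems.PrintX9JetchevX9SwapOfNamedFacts
import HarnessLib

/-!
# Route `PrintX9`, crux J = `HeegnerDivisibilityX9` (item stmt-BirchSwinnertonDyer-20392): **`stub_jetchevX9` FROM THREE NAMED
# LITERATURE FACTS** and the ROUTE-FREE GLUE for the planner's split of J — the BODY of
# `Theses.PrintX9.HeegnerDivisibilityX9` VERBATIM from `(hMC : MultiPrimeX9) (hPF : JetchevPrintFactsX9)`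

Cell `bsd-print-x9` (print tier, key `x9`), prover seat p4; `--supports stmt-BirchSwinnertonDyer-20392`, helper (the
item is NOT closed: the multi-carrier regime `stub_multiPrime` has no source); THEOREMS ONLY, ROUTE-FREE (no import of
`Theses.PrintX9`: the gate imports this module INTO the re-rendered route file for `route edit --split … --glue-by`, plan g3
INBOX 18:37Z), nothing booked, BSD is not proved by any of this.

WHAT.
* `jetchevX9_of_namedFacts h37 hPT hF1 : ‹stub_jetchevX9 VERBATIM›` — Jetchev 2008 Thm. 1.4 (`m_∞ ≥ ord_p c_q`, one carrier
  `q ∣ N_E` at a time) on every X9 Heegner frame of discriminant `|d_K| > 4`, read at the IRREDUCIBLE NON-surjective X9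
  image, is a KERNEL THEOREM modulo the three named Literature facts {Gross 1991 Prop. 3.7 (2)
  `GrossLMS1991.prop37_2_frobeniusCongruence`, Poitou–Tate duality for Selmer structures
  `poitouTate_selmerStructure_duality_conj`, [GZ86 III (3.1)] image-free `Gross1991_heegnerPoint_sub_ratTorsion_mem_E0_imageFree`}:
  the swap-keyed bridge `jetchevX9_of_swapX9_of_namedFacts` (`PrintX9JetchevX9SwapBridge`: Thm. 5.2 node + Prop. 5.3 walk +
  abstract §6 on X9 frames) fed with `swapX9_of_namedFacts` (`PrintX9JetchevX9SwapOfNamedFacts`: Kolyvagin's prime swap =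
  McCallum Prop. 5.2 on X9 frames, X9 port of bsd-jet pv-2's strike). Every use of Jetchev's Hypothesis (∗) (surjectivity) —
  Čebotarev Lemma 6.1 (with level shift), `E(K[c])[p^k] = 0`, the sign, Gross's disjointness — is replaced by a KERNEL
  theorem on the X9 leaf (ty2's discharge interface files E/F/H; x11b3's irreducible no-torsion; `p` split ⇒ unramified).
  beyond-print: YES (Jetchev 2008 prints Thm. 1.4 under (∗) = `ρ_{E,p}` onto; Miller 2011 Thm. 5.4 states the Cha case).
* `heegnerDivisibilityX9_of_multiCarrier_of_printFacts_routeFree (hMC) (hPF) : ‹body of J›` — the registered skeleton's case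
  split with the single-carrier regime DISCHARGED: children for the split = MultiPrimeX9 (crux, = `stub_multiPrime` verbatim:
  at least two Tamagawa carriers — no printed source even under surjectivity except BCGS 2026 Thm. 2) + JetchevPrintFactsX9
  (support, the bundle of the three facts). RECOMMENDED glue-by.
* `heegnerDivisibilityX9_of_swapX9_of_multiCarrier_of_printFacts_routeFree (hSW) (hMC) (hPF)` — the earlier three-child
  glue (SwapX9 displayed as a reading), kept for the record; `hSW` is now superfluous (`swapX9_of_namedFacts`).
CONDITIONAL on the displayed binders; nothing asserted about any curve.

References: [cite: Jetchev2008, Thm. 1.4 (p. 812), Thm. 5.2, Prop. 5.3, Lemma 5.1, Rem. 6.2, proof of Thm. 1.1 (p. 824)]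
[cite: McCallumLMS1991, §3 Cor. 3.2, §4 Prop. 4.4, §5 Prop. 5.2 (p. 304)] [cite: BurungaleEtAl2026, Thm. 2 and §2.2, Prop. 2.2.1]
[cite: GrossLMS1991, Prop. 3.7 (2), §6] [cite: GrossZagier1986Heegner, III (3.1)] [cite: Miller2011LMS, Thm. 5.4].
-/

set_option autoImplicit false

noncomputable section

open scoped Classical

namespace Summit.BirchSwinnertonDyer.Rank1Residual.JET.Split

open WeierstrassCurve Literature.NumberTheory.EllipticCurves
  Literature.NumberTheory.EllipticCurves.ModularForms
  Literature.NumberTheory.EllipticCurves.Rank1Residual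
  Literature.NumberTheory.GaloisCohomology
  Summit.BirchSwinnertonDyer.Rank1Residual Summit.BirchSwinnertonDyer.Rank1Residual.JET
  Summit.BirchSwinnertonDyer.BirchSwinnertonDyer.Theorems

/-! ### §1 The registered stub `stub_jetchevX9` from three named Literature facts -/

/-- **`stub_jetchevX9` (crux 20392, registered signature VERBATIM) ⟸ {Gross 1991 Prop. 3.7 (2), Poitou–Tate for Selmer
structures, [GZ86 III (3.1)] image-free}** — Jetchev's global divisibility `m_∞ ≥ ord_p c_q` (one carrier at a time) on the
X9 Heegner frames at IRREDUCIBLE NON-surjective image: the swap-keyed bridge fed with the kernel swap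
`swapX9_of_namedFacts`. CONDITIONAL on the three named facts only; nothing asserted about any curve.
[cite: Jetchev2008, Thm. 1.4 (p. 812), Rem. 6.2] [cite: McCallumLMS1991, §5 Prop. 5.2 (p. 304)] -/
theorem jetchevX9_of_namedFacts
    (h37 : GrossLMS1991.prop37_2_frobeniusCongruence)
    (hPT : ∀ (K : Type) [Field K] [NumberField K], poitouTate_selmerStructure_duality_conj K)
    (hF1 : Gross1991_heegnerPoint_sub_ratTorsion_mem_E0_imageFree) :
    ∀ (W : WeierstrassCurve ℚ) [W.IsElliptic] [W.IsGloballyMinimal] [NeZero (W.conductorNorm ℤ)] (p : ℕ)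
      [Fact p.Prime], Literature.NumberTheory.EllipticCurves.Rank1Residual.ClassX9 W p → W.analyticRank ≤ 1 →
      ∃ B : ℕ, ∀ (K : Type) [Field K] [NumberField K]
        (Dt : Literature.NumberTheory.EllipticCurves.ModularForms.ModularParametrizationData W (W.conductorNorm ℤ))
        (β : ℤ) (ι : K →+* ℂ), Literature.NumberTheory.EllipticCurves.IsImaginaryQuadratic K →
        B < (NumberField.discr K).natAbs →
        Literature.NumberTheory.EllipticCurves.SatisfiesHeegnerHypothesis (W.conductorNorm ℤ) K →
        Literature.NumberTheory.EllipticCurves.SatisfiesHeegnerHypothesis p K →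
        (4 * (W.conductorNorm ℤ : ℤ)) ∣ β ^ 2 - NumberField.discr K → ¬ (p : ℤ) ∣ Dt.c →
        ∀ (d₁ : Literature.NumberTheory.EllipticCurves.KolyvaginHeegnerData Dt β ι 1),
          ¬ IsOfFinAddOrder d₁.derivedPoint →
        ∀ (q : ℕ) [Fact q.Prime], q ∣ W.conductorNorm ℤ →
        ∀ (s : ℕ), s ≤ padicValNat p ((W.baseChange ℚ_[q]).localTamagawaNumber ℤ_[q]) →
        ∀ (n : ℕ) (d : Literature.NumberTheory.EllipticCurves.KolyvaginHeegnerData Dt β ι n), Squarefree n →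
          (∀ ℓ ∈ n.primeFactors,
            Literature.NumberTheory.EllipticCurves.Zhang2014.IsKolyvaginPrime (W.conductorNorm ℤ) W K p ℓ ∧
              s ≤ Literature.NumberTheory.EllipticCurves.Zhang2014.kolyvaginIndex W p ℓ) →
          ∃ Q : (W.baseChange (Literature.NumberTheory.EllipticCurves.ringClassField K ι n)).toAffine.Point,
            ((p ^ s : ℕ) : ℤ) • Q = d.derivedPoint :=
  jetchevX9_of_swapX9_of_namedFacts (swapX9_of_namedFacts h37 hPT hF1) h37 hPT hF1

/-! ### §2 The route-free glue: the body of J from `MultiPrimeX9` and the print-facts bundle -/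

/-- **Crux J (body VERBATIM) ⟸ `MultiPrimeX9` ∧ `JetchevPrintFactsX9`** — route-free glue for the split of item 20392 into
TWO children: the skeleton's case split (one carrier `q ∣ N_E` absorbs the whole `p`-adic Tamagawa depth `t = ord_p ∏ c_ℓ`,
or not) with the single-carrier regime supplied by `jetchevX9_of_namedFacts hPF.1 hPF.2.1 hPF.2.2`; `hMC` is the registered
stub `stub_multiPrime` verbatim. CONDITIONAL on the two closed binders; the item stays open (MultiPrimeX9 has no source).
[cite: Jetchev2008, Thm. 1.4 (p. 812)] [cite: BurungaleEtAl2026, Thm. 2] -/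
theorem heegnerDivisibilityX9_of_multiCarrier_of_printFacts_routeFree
    (hMC : ∀ (W : WeierstrassCurve ℚ) [W.IsElliptic] [W.IsGloballyMinimal] [NeZero (W.conductorNorm ℤ)] (p : ℕ) [Fact p.Prime], Literature.NumberTheory.EllipticCurves.Rank1Residual.ClassX9 W p → W.analyticRank ≤ 1 → ¬ (∃ (q : ℕ) (_ : Fact q.Prime), q ∣ W.conductorNorm ℤ ∧ padicValNat p W.tamagawaProduct ≤ padicValNat p ((W.baseChange ℚ_[q]).localTamagawaNumber ℤ_[q])) → ∃ B : ℕ, ∀ (K : Type) [Field K] [NumberField K] (Dt : Literature.NumberTheory.EllipticCurves.ModularForms.ModularParametrizationData W (W.conductorNorm ℤ)) (β : ℤ) (ι : K →+* ℂ), Literature.NumberTheory.EllipticCurves.IsImaginaryQuadratic K → B < (NumberField.discr K).natAbs → Literature.NumberTheory.EllipticCurves.SatisfiesHeegnerHypothesis (W.conductorNorm ℤ) K → Literature.NumberTheory.EllipticCurves.SatisfiesHeegnerHypothesis p K → (4 * (W.conductorNorm ℤ : ℤ)) ∣ β ^ 2 - NumberField.discr K → ¬ (p : ℤ) ∣ Dt.c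 → ∀ (d₁ : Literature.NumberTheory.EllipticCurves.KolyvaginHeegnerData Dt β ι 1), ¬ IsOfFinAddOrder d₁.derivedPoint → ∀ (s : ℕ), s ≤ padicValNat p W.tamagawaProduct → ∀ (n : ℕ) (d : Literature.NumberTheory.EllipticCurves.KolyvaginHeegnerData Dt β ι n), Squarefree n → (∀ ℓ ∈ n.primeFactors, Literature.NumberTheory.EllipticCurves.Zhang2014.IsKolyvaginPrime (W.conductorNorm ℤ) W K p ℓ ∧ s ≤ Literature.NumberTheory.EllipticCurves.Zhang2014.kolyvaginIndex W p ℓ) → ∃ Q : (W.baseChange (Literature.NumberTheory.EllipticCurves.ringClassField K ι n)).toAffine.Point, ((p ^ s : ℕ) : ℤ) • Q = d.derivedPoint)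
    (hPF : Literature.NumberTheory.EllipticCurves.GrossLMS1991.prop37_2_frobeniusCongruence ∧
      (∀ (K : Type) [Field K] [NumberField K],
        Literature.NumberTheory.GaloisCohomology.poitouTate_selmerStructure_duality_conj K) ∧
      Literature.NumberTheory.EllipticCurves.Gross1991_heegnerPoint_sub_ratTorsion_mem_E0_imageFree) :
    ∀ (W : WeierstrassCurve ℚ) [W.IsElliptic] [W.IsGloballyMinimal] [NeZero (W.conductorNorm ℤ)] (p : ℕ) [Fact p.Prime], Literature.NumberTheory.EllipticCurves.Rank1Residual.ClassX9 W p → W.analyticRank ≤ 1 → ∃ B : ℕ, ∀ (K : Type) [Field K] [NumberField K] (Dt : Literature.NumberTheory.EllipticCurves.ModularForms.ModularParametrizationData W (W.conductorNorm ℤ)) (β : ℤ) (ι : K →+* ℂ), Literature.NumberTheory.EllipticCurves.IsImaginaryQuadratic K → B < (NumberField.discr K).natAbs → Literature.NumberTheory.EllipticCurves.SatisfiesHeegnerHypothesis (W.conductorNorm ℤ) K → Literature.NumberTheory.EllipticCurves.SatisfiesHeegnerHypothesis p K → (4 * (W.conductorNorm ℤ : ℤ)) ∣ β ^ 2 - NumberField.discr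 K → ¬ (p : ℤ) ∣ Dt.c → ∀ (d₁ : Literature.NumberTheory.EllipticCurves.KolyvaginHeegnerData Dt β ι 1), ¬ IsOfFinAddOrder d₁.derivedPoint → ∀ (s : ℕ), s ≤ padicValNat p W.tamagawaProduct → ∀ (n : ℕ) (d : Literature.NumberTheory.EllipticCurves.KolyvaginHeegnerData Dt β ι n), Squarefree n → (∀ ℓ ∈ n.primeFactors, Literature.NumberTheory.EllipticCurves.Zhang2014.IsKolyvaginPrime (W.conductorNorm ℤ) W K p ℓ ∧ s ≤ Literature.NumberTheory.EllipticCurves.Zhang2014.kolyvaginIndex W p ℓ) → ∃ Q : (W.baseChange (Literature.NumberTheory.EllipticCurves.ringClassField K ι n)).toAffine.Point, ((p ^ s : ℕ) : ℤ) • Q = d.derivedPoint := by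
  intro W _ _ _ p _ hX9 hr
  by_cases hR : (∃ (q : ℕ) (_ : Fact q.Prime), q ∣ W.conductorNorm ℤ ∧ padicValNat p W.tamagawaProduct ≤
      padicValNat p ((W.baseChange ℚ_[q]).localTamagawaNumber ℤ_[q]))
  · obtain ⟨B, hB⟩ := jetchevX9_of_namedFacts hPF.1 hPF.2.1 hPF.2.2 W p hX9 hr
    obtain ⟨q, hq, hqN, hle⟩ := hR
    haveI : Fact q.Prime := hq
    refine ⟨B, ?_⟩
    intro K _ _ Dt β ι hK hBK hH hHp hβ hc d₁ hd₁ s hs n d hn hℓ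
    exact hB K Dt β ι hK hBK hH hHp hβ hc d₁ hd₁ q hqN s (hs.trans hle) n d hn hℓ
  · exact hMC W p hX9 hr hR

/-! ### §3 The earlier three-child glue (SwapX9 displayed as a reading), for the record -/

/-- **Crux J (body VERBATIM) ⟸ `SwapX9` ∧ `MultiPrimeX9` ∧ `JetchevPrintFactsX9`** — the glue keyed on the swap reading
(now a theorem: `swapX9_of_namedFacts`), kept for the record. CONDITIONAL on the three closed binders.
[cite: Jetchev2008, Thm. 1.4 (p. 812)] [cite: McCallumLMS1991, §5 Prop. 5.2] [cite: BurungaleEtAl2026, Thm. 2] -/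
theorem heegnerDivisibilityX9_of_swapX9_of_multiCarrier_of_printFacts_routeFree
    (hSW : ∀ (W : WeierstrassCurve ℚ) [W.IsElliptic] [W.IsGloballyMinimal] [NeZero (W.conductorNorm ℤ)],
        ∀ (K : Type) [Field K] [NumberField K], Literature.NumberTheory.EllipticCurves.IsImaginaryQuadratic K →
        NumberField.discr K ≠ -3 → NumberField.discr K ≠ -4 →
        Literature.NumberTheory.EllipticCurves.SatisfiesHeegnerHypothesis (W.conductorNorm ℤ) K →
        ∀ (p : ℕ) [Fact p.Prime], Literature.NumberTheory.EllipticCurves.Rank1Residual.ClassX9 W p → Literature.NumberTheory.EllipticCurves.SatisfiesHeegnerHypothesis p K →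
        ∀ (Dt : Literature.NumberTheory.EllipticCurves.ModularForms.ModularParametrizationData W (W.conductorNorm ℤ)) (β : ℤ) (ι : K →+* ℂ)
          (d₁ : Literature.NumberTheory.EllipticCurves.KolyvaginHeegnerData Dt β ι 1), ¬ IsOfFinAddOrder d₁.derivedPoint →
        ∀ (M e : ℕ) (n : ℕ) (d : Literature.NumberTheory.EllipticCurves.KolyvaginHeegnerData Dt β ι n), Squarefree n →
          (∀ ℓ ∈ n.primeFactors, Literature.NumberTheory.EllipticCurves.Zhang2014.IsKolyvaginPrime (W.conductorNorm ℤ) W K p ℓ ∧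
            M + 1 ≤ Literature.NumberTheory.EllipticCurves.Zhang2014.kolyvaginIndex W p ℓ) →
          (∀ (n' : ℕ) (d' : Literature.NumberTheory.EllipticCurves.KolyvaginHeegnerData Dt β ι n'), Squarefree n' →
            (∀ ℓ ∈ n'.primeFactors, Literature.NumberTheory.EllipticCurves.Zhang2014.IsKolyvaginPrime (W.conductorNorm ℤ) W K p ℓ ∧
              M + 1 ≤ Literature.NumberTheory.EllipticCurves.Zhang2014.kolyvaginIndex W p ℓ) →
            (∃ Q : (W.baseChange (Literature.NumberTheory.EllipticCurves.ringClassField K ι n')).toAffine.Point,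
              ((p ^ M : ℕ) : ℤ) • Q = d'.derivedPoint)) →
          (¬ ∃ Q : (W.baseChange (Literature.NumberTheory.EllipticCurves.ringClassField K ι n)).toAffine.Point,
            ((p ^ (M + 1) : ℕ) : ℤ) • Q = d.derivedPoint) →
          ∃ (n' : ℕ) (d' : Literature.NumberTheory.EllipticCurves.KolyvaginHeegnerData Dt β ι n'), Squarefree n' ∧
            (∀ ℓ ∈ n'.primeFactors, Literature.NumberTheory.EllipticCurves.Zhang2014.IsKolyvaginPrime (W.conductorNorm ℤ) W K p ℓ ∧
              e ≤ Literature.NumberTheory.EllipticCurves.Zhang2014.kolyvaginIndex W p ℓ) ∧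
            ¬ ∃ Q : (W.baseChange (Literature.NumberTheory.EllipticCurves.ringClassField K ι n')).toAffine.Point,
              ((p ^ (M + 1) : ℕ) : ℤ) • Q = d'.derivedPoint)
    (hMC : ∀ (W : WeierstrassCurve ℚ) [W.IsElliptic] [W.IsGloballyMinimal] [NeZero (W.conductorNorm ℤ)] (p : ℕ) [Fact p.Prime], Literature.NumberTheory.EllipticCurves.Rank1Residual.ClassX9 W p → W.analyticRank ≤ 1 → ¬ (∃ (q : ℕ) (_ : Fact q.Prime), q ∣ W.conductorNorm ℤ ∧ padicValNat p W.tamagawaProduct ≤ padicValNat p ((W.baseChange ℚ_[q]).localTamagawaNumber ℤ_[q])) → ∃ B : ℕ, ∀ (K : Type) [Field K] [NumberField K] (Dt : Literature.NumberTheory.EllipticCurves.ModularForms.ModularParametrizationData W (W.conductorNorm ℤ)) (β : ℤ) (ι : K →+* ℂ), Literature.NumberTheory.EllipticCurves.IsImaginaryQuadratic K → B < (NumberField.discr K).natAbs → Literature.NumberTheory.EllipticCurves.SatisfiesHeegnerHypothesis (W.conductorNorm ℤ) K → Literature.NumberTheory.EllipticCurves.SatisfiesHeegnerHypothesis p K →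 (4 * (W.conductorNorm ℤ : ℤ)) ∣ β ^ 2 - NumberField.discr K → ¬ (p : ℤ) ∣ Dt.c → ∀ (d₁ : Literature.NumberTheory.EllipticCurves.KolyvaginHeegnerData Dt β ι 1), ¬ IsOfFinAddOrder d₁.derivedPoint → ∀ (s : ℕ), s ≤ padicValNat p W.tamagawaProduct → ∀ (n : ℕ) (d : Literature.NumberTheory.EllipticCurves.KolyvaginHeegnerData Dt β ι n), Squarefree n → (∀ ℓ ∈ n.primeFactors, Literature.NumberTheory.EllipticCurves.Zhang2014.IsKolyvaginPrime (W.conductorNorm ℤ) W K p ℓ ∧ s ≤ Literature.NumberTheory.EllipticCurves.Zhang2014.kolyvaginIndex W p ℓ) → ∃ Q : (W.baseChange (Literature.NumberTheory.EllipticCurves.ringClassField K ι n)).toAffine.Point, ((p ^ s : ℕ) : ℤ) • Q = d.derivedPoint)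
    (hPF : Literature.NumberTheory.EllipticCurves.GrossLMS1991.prop37_2_frobeniusCongruence ∧
      (∀ (K : Type) [Field K] [NumberField K],
        Literature.NumberTheory.GaloisCohomology.poitouTate_selmerStructure_duality_conj K) ∧
      Literature.NumberTheory.EllipticCurves.Gross1991_heegnerPoint_sub_ratTorsion_mem_E0_imageFree) :
    ∀ (W : WeierstrassCurve ℚ) [W.IsElliptic] [W.IsGloballyMinimal] [NeZero (W.conductorNorm ℤ)] (p : ℕ) [Fact p.Prime], Literature.NumberTheory.EllipticCurves.Rank1Residual.ClassX9 W p → W.analyticRank ≤ 1 → ∃ B : ℕ, ∀ (K : Type) [Field K] [NumberField K] (Dt : Literature.NumberTheory.EllipticCurves.ModularForms.ModularParametrizationData W (W.conductorNorm ℤ)) (β : ℤ) (ι : K →+* ℂ), Literature.NumberTheory.EllipticCurves.IsImaginaryQuadratic K → B < (NumberField.discr K).natAbs → Literature.NumberTheory.EllipticCurves.SatisfiesHeegnerHypothesis (W.conductorNorm ℤ) K → Literature.NumberTheory.EllipticCurves.SatisfiesHeegnerHypothesis p K → (4 * (W.conductorNorm ℤ : ℤ)) ∣ β ^ 2 - NumberField.discr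 K → ¬ (p : ℤ) ∣ Dt.c → ∀ (d₁ : Literature.NumberTheory.EllipticCurves.KolyvaginHeegnerData Dt β ι 1), ¬ IsOfFinAddOrder d₁.derivedPoint → ∀ (s : ℕ), s ≤ padicValNat p W.tamagawaProduct → ∀ (n : ℕ) (d : Literature.NumberTheory.EllipticCurves.KolyvaginHeegnerData Dt β ι n), Squarefree n → (∀ ℓ ∈ n.primeFactors, Literature.NumberTheory.EllipticCurves.Zhang2014.IsKolyvaginPrime (W.conductorNorm ℤ) W K p ℓ ∧ s ≤ Literature.NumberTheory.EllipticCurves.Zhang2014.kolyvaginIndex W p ℓ) → ∃ Q : (W.baseChange (Literature.NumberTheory.EllipticCurves.ringClassField K ι n)).toAffine.Point, ((p ^ s : ℕ) : ℤ) • Q = d.derivedPoint := by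
  intro W _ _ _ p _ hX9 hr
  by_cases hR : (∃ (q : ℕ) (_ : Fact q.Prime), q ∣ W.conductorNorm ℤ ∧ padicValNat p W.tamagawaProduct ≤
      padicValNat p ((W.baseChange ℚ_[q]).localTamagawaNumber ℤ_[q]))
  · obtain ⟨B, hB⟩ := jetchevX9_of_swapX9_of_namedFacts hSW hPF.1 hPF.2.1 hPF.2.2 W p hX9 hr
    obtain ⟨q, hq, hqN, hle⟩ := hR
    haveI : Fact q.Prime := hq
    refine ⟨B, ?_⟩
    intro K _ _ Dt β ι hK hBK hH hHp hβ hc d₁ hd₁ s hs n d hn hℓ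
    exact hB K Dt β ι hK hBK hH hHp hβ hc d₁ hd₁ q hqN s (hs.trans hle) n d hn hℓ
  · exact hMC W p hX9 hr hR


end Summit.BirchSwinnertonDyer.Rank1Residual.JET.Split

end
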